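import Mathlib

/-!
# Tier7/Line3/Unfolding — the unfolding identity, a.e. absolute convergence and `Γ`-invariance of the Poincaré series

Filer: t7-L1-p3 (gen 3, prover-pub-hodge-repro2-t7-L1-p3-g3-0), TARGET line STATUS l. 15086. Lane: SUPPORT for
Line 3's version-(ii) chain (L3-ARGUMENT.md §2e (a) «geometric kernel»; memo v10 §2f right-hand column item (5),
the UNFOLDING half); NOT a line, NOT a device.

WHAT IT SUPPLIES. The unfolding step behind the geometric side of the two-torus relative trace formula: the
Poincaré series `K_f(x, y) = ∑_{γ ∈ Γ} f(x⁻¹ γ y)` of an `f ∈ L¹(G)` — (U1) the unfolding identity over a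
fundamental domain for ANY measurable action of a countable group (the form the two periods over `[T_A] × [T_B]`
also use), (U1′) its absolute convergence for a.e. `y`, (U3) its `Γ`-invariance in each variable. Everything is
over Mathlib's `IsFundamentalDomain` (`∫_{Γ\G}` is `∫ y in s`). Statements:

* `integral_eq_setIntegral_tsum` (U1): for a countable group `Γ` acting measurably on `α`, `μ` invariant, `s` a
  fundamental domain and `F` integrable, `∫ x, F x ∂μ = ∫ x in s, ∑' γ : Γ, F (γ • x) ∂μ`
  (Mathlib's `integral_eq_tsum''` + `integral_tsum`, the majorant by the `ℝ≥0∞` unfolding `lintegral_eq_tsum''`);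
* (U2) — the representation `∫ g, f g * φ (x * g) ∂μ = ∫ y in s, (∑' γ : Γ, f (x⁻¹ * γ * y)) * φ y ∂μ` itself
  («`(R(f)φ)(x) = ∫_{Γ\G} K_f(x, y) φ(y) dy`») is NOT in this file: it is p1's `T7SupportUnfolding.rightRegular_eq_integral_poincare`
  (TARGET STATUS l. 15091, posted while this file was being checked; yielded to p1 to avoid a twin — my l. 15086 (U2)
  is withdrawn, this file lands the complement);
* `ae_summable_norm` (U1′): for integrable `F` the unfolded series converges absolutely for a.e. `x ∈ s`
  (so the Poincaré series `K_f(x, ·)` converges absolutely a.e. on `Γ\G` for every `f ∈ L¹`);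
* `tsum_mul_left_eq` / `tsum_mul_right_eq` (U3): the Poincaré series is left-`Γ`-invariant in each variable.

NOT in this file: the absolute / uniform convergence of `K_f` for the real test functions (count × decay —
L1-p1 g2's target, l. 15074) and anything about `X`; nothing about the step (P) is claimed.

§8(d) (uses an L-value-free non-vanishing device): NO — unfolding / convergence / invariance lemmas.
-/

namespace Summit.Ventures.HodgeRepro2.Tier7.Line3.Unfolding

open MeasureTheory
open scoped ENNReal NNReal

section General

variable {Γ α : Type*} [Group Γ] [Countable Γ] [MeasurableSpace Γ] [MulAction Γ α]
  [MeasurableSpace α] [MeasurableSMul Γ α] {μ : Measure α} [SMulInvariantMeasure Γ α μ] {s : Set α}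

/-- (U1) **Unfolding.** For a fundamental domain `s` of a countable group `Γ` acting on `α` with invariant
measure `μ`, and an integrable `F`, `∫ F = ∫_s ∑_γ F(γ • x)`. -/
theorem integral_eq_setIntegral_tsum (hs : IsFundamentalDomain Γ s μ) (F : α → ℂ)
    (hF : Integrable F μ) :
    ∫ x, F x ∂μ = ∫ x in s, ∑' γ : Γ, F (γ • x) ∂μ := by
  rw [hs.integral_eq_tsum'' F hF]
  symm
  apply integral_tsum
  · intro γ
    exact (hF.aestronglyMeasurable.comp_measurePreserving (measurePreserving_smul γ μ)).restrict
  · rw [← hs.lintegral_eq_tsum'' (fun x => ‖F x‖ₑ)]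
    exact hF.hasFiniteIntegral.ne

/-- (U1′) **Absolute convergence a.e.** For a fundamental domain `s` of a countable group `Γ` acting on `α`
with invariant measure `μ` and an integrable `F`, the unfolded series `∑_γ F(γ • x)` converges absolutely for
`μ`-a.e. `x ∈ s` (and its `ℝ≥0∞`-majorant integrates to `∫⁻ ‖F‖ₑ`). -/
theorem ae_summable_norm (hs : IsFundamentalDomain Γ s μ) (F : α → ℂ) (hF : Integrable F μ) :
    ∀ᵐ x ∂(μ.restrict s), Summable fun γ : Γ => ‖F (γ • x)‖ := by
  have hmeas : ∀ γ : Γ, AEMeasurable (fun x => ‖F (γ • x)‖ₑ) (μ.restrict s) := fun γ =>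
    ((hF.aestronglyMeasurable.comp_measurePreserving (measurePreserving_smul γ μ)).restrict).enorm
  have hfin : ∫⁻ x in s, ∑' γ : Γ, ‖F (γ • x)‖ₑ ∂μ ≠ ∞ := by
    rw [lintegral_tsum hmeas, ← hs.lintegral_eq_tsum'' (fun x => ‖F x‖ₑ)]
    exact hF.hasFiniteIntegral.ne
  have hae := ae_lt_top' (AEMeasurable.tsum hmeas) hfin
  filter_upwards [hae] with x hx
  have h1 : (∑' γ : Γ, ((‖F (γ • x)‖₊ : ℝ≥0) : ℝ≥0∞)) ≠ ∞ := by
    simpa only [enorm_eq_nnnorm] using hx.ne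
  have h2 : Summable fun γ : Γ => ‖F (γ • x)‖₊ := ENNReal.tsum_coe_ne_top_iff_summable.mp h1
  exact NNReal.summable_coe.mpr h2

end General

section Poincare

variable {G : Type*} [Group G] [MeasurableSpace G] [MeasurableMul G] {μ : Measure G}
  [μ.IsMulLeftInvariant] {Γ : Subgroup G} [Countable Γ] {s : Set G}

omit [MeasurableSpace G] [MeasurableMul G] [Countable Γ] in
/-- (U3) The Poincaré series `K_f(x, y) = ∑_{γ ∈ Γ} f (x⁻¹ γ y)` is left-`Γ`-invariant in `x`. -/
theorem tsum_mul_left_eq (f : G → ℂ) (x y : G) (γ₀ : Γ) :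
    ∑' γ : Γ, f (((γ₀ : G) * x)⁻¹ * γ * y) = ∑' γ : Γ, f (x⁻¹ * γ * y) := by
  have h := (Equiv.mulLeft γ₀⁻¹).tsum_eq (fun γ : Γ => f (x⁻¹ * γ * y))
  rw [← h]
  apply tsum_congr
  intro γ
  simp only [Equiv.coe_mulLeft, Subgroup.coe_mul, Subgroup.coe_inv, mul_inv_rev, mul_assoc]

omit [MeasurableSpace G] [MeasurableMul G] [Countable Γ] in
/-- (U3) The Poincaré series `K_f(x, y) = ∑_{γ ∈ Γ} f (x⁻¹ γ y)` is left-`Γ`-invariant in `y`. -/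
theorem tsum_mul_right_eq (f : G → ℂ) (x y : G) (γ₀ : Γ) :
    ∑' γ : Γ, f (x⁻¹ * γ * ((γ₀ : G) * y)) = ∑' γ : Γ, f (x⁻¹ * γ * y) := by
  have h := (Equiv.mulRight γ₀).tsum_eq (fun γ : Γ => f (x⁻¹ * γ * y))
  rw [← h]
  apply tsum_congr
  intro γ
  simp only [Equiv.coe_mulRight, Subgroup.coe_mul, mul_assoc]

end Poincare

end Summit.Ventures.HodgeRepro2.Tier7.Line3.Unfolding
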